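import Literature.Algebra.Polynomial.CircuitNumberNonnegativity

/-!
# Midpoint circuits are sums of binomial squares

[cite: IlimanDewolff2016GP, Definition 4 («A(L) = {½(s + t) ∈ ℕⁿ : s, t ∈ L ∩ (2ℕ)ⁿ} … L is
P̂-mediated if … every β ∈ L ∖ P̂ is a midpoint of two distinct even points in L»), Theorem 7
(«Let f = λ_0 + ∑ b_j x^{α(j)} + c x^β be a nonnegative circuit polynomial … f is a sum of squares
⟺ f is a sum of binomial squares ⟺ β ∈ (New(f))*»), Theorem 5 (Reznick: A(P̂) ⊆ P*)]
[cite: Reznick1989, §2–§4 (agiforms on mediated sets are sums of binomial squares; as quoted in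
IlimanDewolff2016GP §2)]
[cite: IlimanDewolff2016, Theorem 3.8 (the circuit number Θ; for λ = (½, ½): Θ = 2 √(b₀ b₁))]

The first mediation level made explicit.  If the inner exponent is the MIDPOINT of two even
outer exponents, `β = ½(2u + 2v) = u + v`, the circuit polynomial
`p = b₀ x^{2u} + b₁ x^{2v} + c x^{u+v}` (`b₀ > 0`) is, with `X = x^u`, `Y = x^v`, the binary
quadratic form `b₀ X² + b₁ Y² + c XY`, and

* `p = (√b₀ X + (c / 2√b₀) Y)² + (b₁ − c²/4b₀) Y²` (`midpoint_sobs`): for `c² ≤ 4 b₀ b₁` an explicit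
  sum of a binomial square and a monomial square (`midpoint_nonneg_of_sq_le`);
* for an EVEN midpoint (`u + v ∈ (2ℕ)ⁿ`, so `XY = (x^{(u+v)/2})²` is itself a monomial square)
  also `p = (√b₀ X − √b₁ Y)² + (c + 2√(b₀ b₁)) XY` (`even_midpoint_sobs`), a sum of binomial and
  monomial squares as soon as `c ≥ −2√(b₀b₁)` (`even_midpoint_nonneg_of_neg_le`);
* the thresholds are the circuit number: `Θ((b₀, b₁), (½, ½)) = 2 √(b₀ b₁)`
  (`circuitNumber_half_half`), so on midpoint circuits the SONC condition `|c| ≤ Θ`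
  (resp. `−Θ ≤ c`) is certified by binomial squares — the case `β ∈ A(P̂)` of Theorem 7.

Instance: `x⁴ + y⁴ + c x² y² = (x² − y²)² + (c + 2) x² y² ≥ 0` for `c ≥ −2`, and `< 0` at `(1,1)`
for `c < −2` (`pow_four_add_pow_four_add_mul_sq_sq_nonneg_iff`).

All statements are fully proved; no named facts are introduced.
-/

namespace Literature.Algebra.Polynomial.CircuitMidpointSquares

open Finset Literature.Algebra.Polynomial.CircuitNumberNonnegativity

/-! ### The binary quadratic form -/

/-- **One mediation step, odd or even midpoint**: for `b₀ > 0`,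
`b₀ X² + b₁ Y² + c XY = (√b₀ X + (c/(2√b₀)) Y)² + (b₁ − c²/(4 b₀)) Y²`.
[cite: IlimanDewolff2016GP, Theorem 7 (β ∈ A(P̂): sum of binomial squares)] -/
theorem quadForm_eq_sq_add {b₀ : ℝ} (hb₀ : 0 < b₀) (b₁ c X Y : ℝ) :
    b₀ * X ^ 2 + b₁ * Y ^ 2 + c * (X * Y)
      = (Real.sqrt b₀ * X + c / (2 * Real.sqrt b₀) * Y) ^ 2 + (b₁ - c ^ 2 / (4 * b₀)) * Y ^ 2 := by
  have hs : Real.sqrt b₀ ^ 2 = b₀ := Real.sq_sqrt hb₀.le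
  set r := Real.sqrt b₀ with hr_def
  have hr : r ≠ 0 := (Real.sqrt_pos.mpr hb₀).ne'
  rw [← hs]
  field_simp
  ring

/-- Hence `c² ≤ 4 b₀ b₁` (`b₀ > 0`) makes the form a sum of two squares with nonnegative weights, in
particular nonnegative. [cite: IlimanDewolff2016GP, Theorem 7] -/
theorem quadForm_nonneg_of_sq_le {b₀ b₁ c : ℝ} (hb₀ : 0 < b₀) (hc : c ^ 2 ≤ 4 * b₀ * b₁)
    (X Y : ℝ) : 0 ≤ b₀ * X ^ 2 + b₁ * Y ^ 2 + c * (X * Y) := by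
  rw [quadForm_eq_sq_add hb₀]
  have h : 0 ≤ b₁ - c ^ 2 / (4 * b₀) := by
    rw [sub_nonneg, div_le_iff₀ (by positivity)]
    linarith
  positivity

/-- **One mediation step, even midpoint**: for `b₀, b₁ ≥ 0`,
`b₀ X² + b₁ Y² + c XY = (√b₀ X − √b₁ Y)² + (c + 2 √(b₀ b₁)) XY` — the extremal agiform
`(√b₀ X − √b₁ Y)²` plus a multiple of `XY`.
[cite: Reznick1989, §2 (the agiform at the boundary is a binomial square; quoted in
IlimanDewolff2016GP §2)] -/
theorem quadForm_eq_sq_add' {b₀ b₁ : ℝ} (hb₀ : 0 ≤ b₀) (hb₁ : 0 ≤ b₁) (c X Y : ℝ) :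
    b₀ * X ^ 2 + b₁ * Y ^ 2 + c * (X * Y)
      = (Real.sqrt b₀ * X - Real.sqrt b₁ * Y) ^ 2 + (c + 2 * Real.sqrt (b₀ * b₁)) * (X * Y) := by
  rw [Real.sqrt_mul hb₀]
  have h0 : Real.sqrt b₀ ^ 2 = b₀ := Real.sq_sqrt hb₀
  have h1 : Real.sqrt b₁ ^ 2 = b₁ := Real.sq_sqrt hb₁
  linear_combination (-(X ^ 2)) * h0 + (-(Y ^ 2)) * h1

/-- Hence for `XY ≥ 0` (an even midpoint: `XY` is a monomial square) and `c ≥ −2 √(b₀ b₁)` the form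
is nonnegative. [cite: IlimanDewolff2016GP, Theorem 7 (with Theorem 3.8's one-sided condition for
even inner exponents)] -/
theorem quadForm_nonneg_of_neg_le {b₀ b₁ c : ℝ} (hb₀ : 0 ≤ b₀) (hb₁ : 0 ≤ b₁)
    (hc : -(2 * Real.sqrt (b₀ * b₁)) ≤ c) {X Y : ℝ} (hXY : 0 ≤ X * Y) :
    0 ≤ b₀ * X ^ 2 + b₁ * Y ^ 2 + c * (X * Y) := by
  rw [quadForm_eq_sq_add' hb₀ hb₁]
  have h : 0 ≤ c + 2 * Real.sqrt (b₀ * b₁) := by linarith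
  positivity

/-- **The threshold is the circuit number**: for the midpoint weights `λ = (½, ½)`,
`Θ((b₀, b₁), λ) = (2 b₀)^{1/2} (2 b₁)^{1/2} = 2 √(b₀ b₁)`; thus `c² ≤ 4 b₀ b₁ ⟺ |c| ≤ Θ`.
[cite: IlimanDewolff2016, Theorem 3.8 (Θ_f = ∏ (b_j/λ_j)^{λ_j})] -/
theorem circuitNumber_half_half {b₀ : ℝ} (hb₀ : 0 ≤ b₀) (b₁ : ℝ) :
    circuitNumber ![b₀, b₁] ![1 / 2, 1 / 2] = 2 * Real.sqrt (b₀ * b₁) := by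
  rw [circuitNumber, Fin.prod_univ_two]
  simp only [Matrix.cons_val_zero, Matrix.cons_val_one]
  rw [← Real.sqrt_eq_rpow, ← Real.sqrt_eq_rpow, ← Real.sqrt_mul (by positivity),
    show b₀ / (1 / 2) * (b₁ / (1 / 2)) = 2 ^ 2 * (b₀ * b₁) by ring,
    Real.sqrt_mul (by positivity), Real.sqrt_sq (by norm_num)]

/-- `c² ≤ 4 b₀ b₁ ⟺ |c| ≤ 2 √(b₀ b₁)` (`b₀, b₁ ≥ 0`): the binomial-square range equals the SONC
range `|c| ≤ Θ` of the midpoint circuit. [cite: IlimanDewolff2016GP, Theorem 7 (for β ∈ A(P̂)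
nonnegativity and the SOS property coincide)] -/
theorem sq_le_iff_abs_le_two_mul_sqrt {b₀ b₁ : ℝ} (hb₀ : 0 ≤ b₀) (hb₁ : 0 ≤ b₁) (c : ℝ) :
    c ^ 2 ≤ 4 * b₀ * b₁ ↔ |c| ≤ 2 * Real.sqrt (b₀ * b₁) := by
  rw [show 4 * b₀ * b₁ = (2 * Real.sqrt (b₀ * b₁)) ^ 2 by
    rw [mul_pow, Real.sq_sqrt (mul_nonneg hb₀ hb₁)]; ring]
  exact sq_le_sq.trans (by rw [abs_of_nonneg (by positivity : (0:ℝ) ≤ 2 * Real.sqrt (b₀ * b₁))])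

/-! ### The circuit polynomial `b₀ x^{2u} + b₁ x^{2v} + c x^{u+v}` -/

variable {n : Type*} [Fintype n]

/-- Monomial bookkeeping: `x^{2u} = (x^u)²`. [folklore] -/
private theorem prod_pow_two_mul (x : n → ℝ) (u : n → ℕ) :
    ∏ i, x i ^ (2 * u i) = (∏ i, x i ^ u i) ^ 2 := by
  rw [← prod_pow]
  exact prod_congr rfl fun i _ => pow_mul' (x i) 2 (u i)

/-- Monomial bookkeeping: `x^{u+v} = x^u x^v`. [folklore] -/
private theorem prod_pow_add (x : n → ℝ) (u v : n → ℕ) :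
    ∏ i, x i ^ (u i + v i) = (∏ i, x i ^ u i) * ∏ i, x i ^ v i := by
  rw [← prod_mul_distrib]
  exact prod_congr rfl fun i _ => pow_add (x i) (u i) (v i)

/-- **Midpoint circuits are sums of binomial squares**: for `b₀ > 0` and all `x ∈ ℝⁿ`,
`b₀ x^{2u} + b₁ x^{2v} + c x^{u+v} = (√b₀ x^u + (c/(2√b₀)) x^v)² + (b₁ − c²/(4b₀)) (x^v)²`.
[cite: IlimanDewolff2016GP, Theorem 7 (the case β ∈ A(P̂) of Definition 4)] -/
theorem midpoint_sobs {b₀ : ℝ} (hb₀ : 0 < b₀) (b₁ c : ℝ) (u v : n → ℕ) (x : n → ℝ) :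
    b₀ * ∏ i, x i ^ (2 * u i) + b₁ * ∏ i, x i ^ (2 * v i) + c * ∏ i, x i ^ (u i + v i)
      = (Real.sqrt b₀ * ∏ i, x i ^ u i + c / (2 * Real.sqrt b₀) * ∏ i, x i ^ v i) ^ 2
        + (b₁ - c ^ 2 / (4 * b₀)) * (∏ i, x i ^ v i) ^ 2 := by
  rw [prod_pow_two_mul, prod_pow_two_mul, prod_pow_add]
  exact quadForm_eq_sq_add hb₀ b₁ c _ _

/-- Hence `c² ≤ 4 b₀ b₁` certifies `b₀ x^{2u} + b₁ x^{2v} + c x^{u+v} ≥ 0` on `ℝⁿ` by binomial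
squares (odd or even midpoint). [cite: IlimanDewolff2016GP, Theorem 7] -/
theorem midpoint_nonneg_of_sq_le {b₀ b₁ c : ℝ} (hb₀ : 0 < b₀) (hc : c ^ 2 ≤ 4 * b₀ * b₁)
    (u v : n → ℕ) (x : n → ℝ) :
    0 ≤ b₀ * ∏ i, x i ^ (2 * u i) + b₁ * ∏ i, x i ^ (2 * v i) + c * ∏ i, x i ^ (u i + v i) := by
  rw [prod_pow_two_mul, prod_pow_two_mul, prod_pow_add]
  exact quadForm_nonneg_of_sq_le hb₀ hc _ _

/-- **Even midpoints**: if `u + v = 2m` then `x^{u+v} = (x^m)² ≥ 0` and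
`b₀ x^{2u} + b₁ x^{2v} + c x^{u+v} = (√b₀ x^u − √b₁ x^v)² + (c + 2√(b₀b₁)) (x^m)²`.
[cite: Reznick1989, §2 (quoted in IlimanDewolff2016GP §2)] [cite: IlimanDewolff2016GP, Theorem 7] -/
theorem even_midpoint_sobs {b₀ b₁ : ℝ} (hb₀ : 0 ≤ b₀) (hb₁ : 0 ≤ b₁) (c : ℝ) {u v m : n → ℕ}
    (hm : ∀ i, u i + v i = 2 * m i) (x : n → ℝ) :
    b₀ * ∏ i, x i ^ (2 * u i) + b₁ * ∏ i, x i ^ (2 * v i) + c * ∏ i, x i ^ (u i + v i)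
      = (Real.sqrt b₀ * ∏ i, x i ^ u i - Real.sqrt b₁ * ∏ i, x i ^ v i) ^ 2
        + (c + 2 * Real.sqrt (b₀ * b₁)) * (∏ i, x i ^ m i) ^ 2 := by
  have h : ∏ i, x i ^ (u i + v i) = (∏ i, x i ^ m i) ^ 2 := by
    rw [← prod_pow_two_mul]
    exact prod_congr rfl fun i _ => by rw [hm i]
  rw [prod_pow_two_mul, prod_pow_two_mul, prod_pow_add, quadForm_eq_sq_add' hb₀ hb₁,
    ← prod_pow_add, h]

/-- Hence for an even midpoint `−2√(b₀b₁) ≤ c` certifies nonnegativity by binomial and monomial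
squares. [cite: IlimanDewolff2016GP, Theorem 7 (with the one-sided condition of Theorem 3.8 for
β ∈ (2ℕ)ⁿ)] -/
theorem even_midpoint_nonneg_of_neg_le {b₀ b₁ c : ℝ} (hb₀ : 0 ≤ b₀) (hb₁ : 0 ≤ b₁)
    (hc : -(2 * Real.sqrt (b₀ * b₁)) ≤ c) {u v m : n → ℕ} (hm : ∀ i, u i + v i = 2 * m i)
    (x : n → ℝ) :
    0 ≤ b₀ * ∏ i, x i ^ (2 * u i) + b₁ * ∏ i, x i ^ (2 * v i) + c * ∏ i, x i ^ (u i + v i) := by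
  rw [even_midpoint_sobs hb₀ hb₁ c hm]
  have h : 0 ≤ c + 2 * Real.sqrt (b₀ * b₁) := by linarith
  positivity

/-! ### Instance -/

/-- `x⁴ + y⁴ + c x² y² = (x² − y²)² + (c + 2) x² y²`: nonnegative on `ℝ²` iff `c ≥ −2` (even
midpoint `(2,2) = ½((4,0) + (0,4))`, `Θ = 2`, one-sided condition).
[cite: IlimanDewolff2016GP, Theorem 7 with Theorem 3.8] -/
theorem pow_four_add_pow_four_add_mul_sq_sq_nonneg_iff (c : ℝ) :
    (∀ x y : ℝ, 0 ≤ x ^ 4 + y ^ 4 + c * (x ^ 2 * y ^ 2)) ↔ -2 ≤ c := by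
  constructor
  · intro h
    have h1 := h 1 1
    norm_num at h1
    linarith
  · intro hc x y
    have hid : x ^ 4 + y ^ 4 + c * (x ^ 2 * y ^ 2)
        = (x ^ 2 - y ^ 2) ^ 2 + (c + 2) * (x * y) ^ 2 := by
      ring
    rw [hid]
    have : 0 ≤ c + 2 := by linarith
    positivity

end Literature.Algebra.Polynomial.CircuitMidpointSquares
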